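import Mathlib
import HarnessLib
import Summits.HubbardSuperconductivity.HubbardSuperconductivity.Theorems.KLProgrammeKLRegimeEngineIsoTorusDefs
import Summits.HubbardSuperconductivity.HubbardSuperconductivity.Theorems.KLProgrammeKLRegimeEngineV8DefsQ5

/-!
# The (E4)₀ constant of the K3 engine's scale-`0` rung: the named statement `E4ScaleZeroAt E` and the closed constant `klE4T`

Cell `gate-hubbard-kl`, seat p3 g6 (DefsG4 author / scale-`0` assembler of record).  Twin of `…EngineIsoTorusDefs` for the fourth
conjunct of `stub_engine_scale0`: k3c2-p1 g3 (owner of (E4)₀, STATUS 2026-08-27 05:02Z) proves the first-moment clause in the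
`G`-parametric form `E₄ ≤ G.cE4 → <stub binders> → EngineFirstMoments L M G P (klEngQ5 P R) β U μ K 0` for a closed absolute constant
`E₄ = klE4CE` that exceeds `klEngGeo3.cE4 = 2^{10}` and is definable only when his weighted-size layer is typed.  So that the ONE
`G`-level swap (`klEngGeo4 := klEngGeo3.raise (klIsoT ^ 4) klE4T`, …EngineV8DefsG4) waits neither on that layer nor on (J3):

* **`E4ScaleZeroAt E`** — «`E` is an admissible (E4)₀ constant»: for every well-formed `G` with `E ≤ G.cE4` and the binders of
  `stub_engine_scale0`, `EngineFirstMoments L M G P (klEngQ5 P R) β U μ K 0`;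
* **`klE4T := if h : (∃ E, 0 ≤ E ∧ E4ScaleZeroAt E) then Classical.choose h else 0`** (classical `if`; a CLOSED term), `klE4T_nonneg`,
  **`e4ScaleZeroAt_klE4T : 0 ≤ E → E4ScaleZeroAt E → E4ScaleZeroAt klE4T`**, `E4ScaleZeroAt.mono`, and the consumer form
  `engineFirstMoments_zero_of_e4ScaleZeroAt` (the clause at any `G` with `klE4T ≤ G.cE4`, from any witness).

No analysis here; the content is k3c2-p1's (E4)₀ chain (`…ScaleZeroE4Defs/Geometry/Assembly`, Literature `GrassmannWeighted…DB`).
-/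

namespace Summit.HubbardSuperconductivity.HubbardSuperconductivity.Theorems.EngineV8

noncomputable section

open Real Finset Literature.MathematicalPhysics.QuantumLattice Literature.Probability.LatticeModels
open Summit.HubbardSuperconductivity.HubbardSuperconductivity.Theorems.KLRegimeSplit
open Summit.HubbardSuperconductivity.HubbardSuperconductivity.Theorems.KLProgrammeLegKernels

/-- **`E4ScaleZeroAt E`** — `E` is an admissible constant for the scale-`0` first-moment clause (E4)₀: for every well-formed `G` with
`E ≤ G.cE4`, under exactly the binders of `stub_engine_scale0`, `EngineFirstMoments L M G P (klEngQ5 P R) β U μ K 0`. -/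
def E4ScaleZeroAt (E : ℝ) : Prop :=
  ∀ (G : GeoConsts), G.WF → E ≤ G.cE4 →
    ∀ (P : SplitConsts) (R : RenConsts) (c : ℝ), P.WF → R.WF2 → 0 < c → c ≤ klEngC₃3 P R → ∀ μ ∈ klWindowC, ∀ U : ℝ, 0 < U →
    U ≤ klEngU₀3 P R c → ∀ β : ℝ, klBetaMin ≤ β → β ≤ Real.exp (c / U ^ 2) → ∀ K : TrigPolyC4v, FrameOK R U (nScales β) μ K →
    ∀ (L M : ℕ) [NeZero L] [NeZero M], klEngL₃ β U ≤ L → klEngM₃ β U L ≤ M → EngineFirstMoments L M G P (klEngQ5 P R) β U μ K 0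

open Classical in
/-- **`klE4T`** — THE (E4)₀ constant of the engine: a nonnegative admissible constant when one exists, `0` otherwise (a closed term; it enters
the `G`-package as `cE4 := max klEngGeo3.cE4 klE4T`). -/
def klE4T : ℝ := if h : (∃ E : ℝ, 0 ≤ E ∧ E4ScaleZeroAt E) then Classical.choose h else 0

/-- `0 ≤ klE4T`. -/
theorem klE4T_nonneg : 0 ≤ klE4T := by
  classical
  unfold klE4T
  split_ifs with h
  · exact (Classical.choose_spec h).1
  · exact le_rfl

/-- **`klE4T` is admissible as soon as any nonnegative constant is** (the form in which k3c2-p1's (E4)₀ theorem is consumed). -/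
theorem e4ScaleZeroAt_klE4T {E : ℝ} (hE0 : 0 ≤ E) (hE : E4ScaleZeroAt E) : E4ScaleZeroAt klE4T := by
  classical
  have h : ∃ E : ℝ, 0 ≤ E ∧ E4ScaleZeroAt E := ⟨E, hE0, hE⟩
  have : klE4T = Classical.choose h := by unfold klE4T; exact dif_pos h
  rw [this]
  exact (Classical.choose_spec h).2

/-- A larger constant is still admissible. -/
theorem E4ScaleZeroAt.mono {E E' : ℝ} (h : E4ScaleZeroAt E) (hEE' : E ≤ E') : E4ScaleZeroAt E' :=
  fun G hG hE' => h G hG (hEE'.trans hE')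

/-- **Consumer form**: from any witness `E4ScaleZeroAt E` (`0 ≤ E`), at every well-formed `G` with `klE4T ≤ G.cE4` the binders of
`stub_engine_scale0` give `EngineFirstMoments L M G P (klEngQ5 P R) β U μ K 0`. -/
theorem engineFirstMoments_zero_of_e4ScaleZeroAt {E : ℝ} (hE0 : 0 ≤ E) (hE : E4ScaleZeroAt E) (G : GeoConsts) (hG : G.WF)
    (hcE4 : klE4T ≤ G.cE4) (P : SplitConsts) (R : RenConsts) (c : ℝ) (hP : P.WF) (hR : R.WF2) (hc : 0 < c) (hc₃ : c ≤ klEngC₃3 P R)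
    (μ : ℝ) (hμ : μ ∈ klWindowC) (U : ℝ) (hU : 0 < U) (hU₀ : U ≤ klEngU₀3 P R c) (β : ℝ) (hβ : klBetaMin ≤ β)
    (hβc : β ≤ Real.exp (c / U ^ 2)) (K : TrigPolyC4v) (hK : FrameOK R U (nScales β) μ K) (L M : ℕ) [NeZero L] [NeZero M]
    (hL : klEngL₃ β U ≤ L) (hM : klEngM₃ β U L ≤ M) : EngineFirstMoments L M G P (klEngQ5 P R) β U μ K 0 :=
  e4ScaleZeroAt_klE4T hE0 hE G hG hcE4 P R c hP hR hc hc₃ μ hμ U hU hU₀ β hβ hβc K hK L M hL hM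

end

end Summit.HubbardSuperconductivity.HubbardSuperconductivity.Theorems.EngineV8
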